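import Summits.BirchSwinnertonDyer.BirchSwinnertonDyer.Theses.TameQuarticManinParity
import Literature.NumberTheory.ModularSymbols.CuspidalHomologyEigenpacketLift
import Literature.NumberTheory.EllipticCurves.GreenbergSelmerOrdinaryFiltrationProofs
import HarnessLib

/-!
# Route `TameQuarticManinParity`: LIFT33 `ModThreePeriodEigenclassLiftsToNewform` (stmt-BirchSwinnertonDyer-23816) BY NAME —
# a mod-`3` Hecke eigenclass in `H₁(X₀(M), ℤ)` lifts to a `Γ₁(M′)`-newform of trivial character congruent to it

Lead seat `cruxlead-stmt-BirchSwinnertonDyer-23367` (crux MS `TprimeIrrModThreeSaturation`, line `abelian-fixed-points`): LIFT33 is the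
W-free Deligne–Serre leaf of the stub L31 (via G33, landed p681634).  PROOF OVER LANDED THEOREMS (no new mathematics):
* `exists_isNewform0_of_genEigenvector_mod_three` (typer defn-ty1 g30, `CuspidalHomologyEigenpacketLift`; Hoffman–Kunze joint
  eigenvector + Deligne–Serre 6.11 on `Λ_M` + Eichler–Shimura by duality against the Atkin–Lehner basis), applied to the primes of
  `S` NOT dividing `M` (so that every generator `T_p` of the order `ℋ/P` maps under `σ` to a genuine Fourier coefficient
  `a_p(g₀) ∈ K_g`): a `Γ₀(M′)`-newform `g₀`, `M′ ∣ M`, an order `ℋ/P` with `ψ : ℋ/P → ℤ/3`, `σ : ℋ/P ↪ ℂ`, `a_p(g₀) = σ(T_p)`,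
  `ψ(T_p) = a_p mod 3`;
* the `Γ₁(M′)`-lift `g` of `g₀` (`liftToGamma1`; `isNewform1_liftToGamma1_iff_holds`, `coe_liftToGamma1_holds`,
  `nebentypus_liftToGamma1_holds`: same `q`-expansion, trivial character) with NUMBER FIELD `K = coeffCharField g`
  (`numberField_coeffCharField_liftToGamma1`);
* `exists_maximal_ideal_over_ker` (§6 of the same file; lying over): `j : ℋ/P → 𝓞_K = coeffCharIntegers g` and a maximal
  `𝔐 ∋ 3` with `j(T_p) ≡ a_p (mod 𝔐)`;
* `ιg : 𝓞_K → 𝓞_K/𝔐 ↪ k` (`IsAlgClosed.lift` over `𝔽₃`; `𝓞_K/𝔐` is integral over `𝔽₃`), under which the integral Hecke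
  polynomial `X² − j(T_p) X + p ∈ 𝓞_K[X]` (it maps to `X² − a_p(g) X + p` in `K_g[X]`, the Hecke polynomial of `g`, character
  trivial, weight `2`) reduces to `X² − ā_p X + p`.
THEOREMS ONLY; no definition, no named fact, no `sorry`.  No summit is proved; BSD is NOT proved.
-/

set_option autoImplicit false
-- D-0017: single-problem summit, so `Summit.BirchSwinnertonDyer.BirchSwinnertonDyer.…` repeats a namespace BY DESIGN.
set_option linter.dupNamespace false

noncomputable section

open scoped MatrixGroups ModularForm Polynomial
open CongruenceSubgroup Polynomial
open Literature.NumberTheory.EllipticCurves.ModularForms Literature.NumberTheory.ModularSymbols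

namespace Summit.BirchSwinnertonDyer.BirchSwinnertonDyer.Theorems.TameQuarticManinParity

open Summit.BirchSwinnertonDyer.BirchSwinnertonDyer.Theses.TameQuarticManinParity

/-- **A ring homomorphism from the quotient of an integral `ℤ`-algebra by a maximal ideal containing the prime `ℓ` into any
algebraically closed field of characteristic `ℓ`** (the residue field is an algebraic extension of `𝔽_ℓ`; `IsAlgClosed.lift`).
[cite: AtiyahMacdonald1969, Cor. 5.8 (integrality passes to quotients)] -/
theorem exists_ringHom_quotient_of_isIntegral {R : Type*} [CommRing R]
    (hint : ∀ r : R, ∃ f : ℤ[X], f.Monic ∧ Polynomial.eval₂ (Int.castRingHom R) r f = 0) (𝔐 : Ideal R)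
    [𝔐.IsMaximal] {ℓ : ℕ} (hℓ : ℓ.Prime) (hℓ𝔐 : (ℓ : R) ∈ 𝔐) (k : Type*) [Field k] [CharP k ℓ] [IsAlgClosed k] :
    ∃ _ι : R ⧸ 𝔐 →+* k, True := by
  classical
  haveI : Fact ℓ.Prime := ⟨hℓ⟩
  letI : Field (R ⧸ 𝔐) := Ideal.Quotient.field 𝔐
  -- characteristic `ℓ`
  have hℓ0 : ((ℓ : ℕ) : R ⧸ 𝔐) = 0 := by
    rw [← map_natCast (Ideal.Quotient.mk 𝔐), Ideal.Quotient.eq_zero_iff_mem]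
    exact hℓ𝔐
  haveI : CharP (R ⧸ 𝔐) ℓ := (CharP.charP_iff_prime_eq_zero hℓ).mpr hℓ0
  letI : Algebra (ZMod ℓ) (R ⧸ 𝔐) := ZMod.algebra _ ℓ
  letI : Algebra (ZMod ℓ) k := ZMod.algebra _ ℓ
  -- `R ⧸ 𝔐` is algebraic over `𝔽_ℓ`: reduce an integral equation over `ℤ`
  haveI : Algebra.IsAlgebraic (ZMod ℓ) (R ⧸ 𝔐) := by
    refine ⟨fun x ↦ ?_⟩
    obtain ⟨r, rfl⟩ := Ideal.Quotient.mk_surjective x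
    obtain ⟨f, hfm, hf⟩ := hint r
    have hint' : IsIntegral (ZMod ℓ) (Ideal.Quotient.mk 𝔐 r) := by
      refine ⟨f.map (Int.castRingHom (ZMod ℓ)), hfm.map _, ?_⟩
      rw [Polynomial.eval₂_map]
      have hcomp : (algebraMap (ZMod ℓ) (R ⧸ 𝔐)).comp (Int.castRingHom (ZMod ℓ)) =
          (Ideal.Quotient.mk 𝔐).comp (Int.castRingHom R) := RingHom.ext_int _ _
      rw [hcomp, ← Polynomial.hom_eval₂, hf, map_zero]
    exact hint'.isAlgebraic
  exact ⟨(IsAlgClosed.lift (R := ZMod ℓ) (M := k) (S := R ⧸ 𝔐)).toRingHom, trivial⟩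

set_option maxHeartbeats 800000 in
-- the route statement and the packet theorem carry long binder telescopes; elaboration of the final `refine` needs head-room
/-- **LIFT33 `ModThreePeriodEigenclassLiftsToNewform` (stmt-BirchSwinnertonDyer-23816) by name.**  A mod-`3` joint generalised
Hecke eigenclass `y ∈ H₁(X₀(M), ℤ) ∖ 3H₁` with eigenvalues `(a_p mod 3)_{p ∈ S}` lifts, for every algebraically closed `k` of
characteristic `3`, to a `Γ₁(M′)`-newform `g` (`M′ ∣ M`) of trivial character with `ιg : 𝓞_g → k` and integral Hecke
polynomials `X² − a_p(g)X + p` reducing under `ιg` to `X² − ā_p X + p` for the primes `p ∈ S`, `p ≠ 3`, `p ∤ M`.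
[cite: DeligneSerre1974, Lemme 6.11 (derived reading: M = H₁(X₀(M),ℤ), ℓ = 3)] [cite: AtkinLehner1970, Thm. 5 with Thm. 3] -/
theorem modThreePeriodEigenclassLiftsToNewform_proof : ModThreePeriodEigenclassLiftsToNewform := by
  intro M _ S a hy k _ _ _ _ _
  classical
  obtain ⟨y, hne, hy⟩ := hy
  -- the primes of `S` away from `M`
  set S' : Finset ℕ := S.filter (fun p ↦ ¬ p ∣ M) with hS'
  have hy' : ∀ (p : ℕ) (hp : p.Prime), p ≠ 3 → p ∈ S' →
      ∃ (n : ℕ) (u : periodHomologyHecke M), (HeckeRing0.T M 2 p hp - (a p : HeckeRing0 M 2)) ^ n • y = (3 : ℕ) • u :=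
    fun p hp hp3 hpS' ↦ hy p hp hp3 (Finset.mem_filter.mp hpS').1
  have hne' : ∀ u : periodHomologyHecke M, y ≠ (3 : ℕ) • u := fun u hu ↦ hne ⟨u, hu⟩
  -- (1) the newform packet
  obtain ⟨P, ψ, σ, M', hM'0, hM'M, g₀, -, -, hfin, hσ, hg₀, hpk⟩ :=
    exists_isNewform0_of_genEigenvector_mod_three M S' a y hy' hne'
  -- (2) the `Γ₁(M′)`-lift
  set g : CuspForm (Gamma1 M') 2 := liftToGamma1 M' 2 g₀ with hgdef
  have hg : IsNewform1 g := (isNewform1_liftToGamma1_iff_holds M' 2 g₀).mpr hg₀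
  have hε : nebentypus g = 1 := nebentypus_liftToGamma1_holds M' 2 hg₀.ne_zero
  have hcoe : (⇑g : UpperHalfPlane → ℂ) = ⇑g₀ := coe_liftToGamma1_holds M' 2 g₀
  haveI : NumberField (coeffCharField g) :=
    Literature.NumberTheory.EllipticCurves.GreenbergSelmer.numberField_coeffCharField_liftToGamma1 hg₀
  -- (3) `σ` takes values in `K = coeffCharField g`
  have hσK : ∀ r, σ r ∈ coeffCharField g := by
    intro r
    obtain ⟨h, rfl⟩ := Ideal.Quotient.mk_surjective r
    obtain ⟨h, hh⟩ := h
    induction hh using Algebra.adjoin_induction with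
    | mem t ht =>
      obtain ⟨p, hp, hp3, hpS', rfl⟩ := ht
      have hpM : ¬ p ∣ M := (Finset.mem_filter.mp hpS').2
      have hc := (hpk p hp hp3 hpS').2 hpM
      rw [← hc]
      have e : cuspCoeff g₀ p = cuspCoeff g p := by rw [cuspCoeff, cuspCoeff, hcoe]
      rw [e]
      exact cuspCoeff_mem_coeffCharField g p
    | algebraMap n =>
      have e : (⟨algebraMap ℤ (HeckeRing0 M 2) n, Subalgebra.algebraMap_mem _ n⟩ :
          ↥(Algebra.adjoin ℤ {t : HeckeRing0 M 2 | ∃ (p : ℕ) (hp : p.Prime), p ≠ 3 ∧ p ∈ S' ∧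
            t = HeckeRing0.T M 2 p hp})) = algebraMap ℤ _ n := rfl
      rw [e, ← Ideal.Quotient.algebraMap_eq, ← IsScalarTower.algebraMap_apply]
      have key : ∀ f : ℤ →+* (↥(Algebra.adjoin ℤ {t : HeckeRing0 M 2 | ∃ (p : ℕ) (hp : p.Prime), p ≠ 3 ∧ p ∈ S' ∧
          t = HeckeRing0.T M 2 p hp}) ⧸ P), σ (f n) ∈ coeffCharField g := fun f ↦ by
        rw [eq_intCast f n, map_intCast]
        exact intCast_mem _ n
      exact key _
    | add u v hu hv ihu ihv =>
      have e : (⟨u + v, Subalgebra.add_mem _ hu hv⟩ :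
          ↥(Algebra.adjoin ℤ {t : HeckeRing0 M 2 | ∃ (p : ℕ) (hp : p.Prime), p ≠ 3 ∧ p ∈ S' ∧
            t = HeckeRing0.T M 2 p hp})) = ⟨u, hu⟩ + ⟨v, hv⟩ := rfl
      rw [e, RingHom.map_add, RingHom.map_add]
      exact add_mem ihu ihv
    | mul u v hu hv ihu ihv =>
      have e : (⟨u * v, Subalgebra.mul_mem _ hu hv⟩ :
          ↥(Algebra.adjoin ℤ {t : HeckeRing0 M 2 | ∃ (p : ℕ) (hp : p.Prime), p ≠ 3 ∧ p ∈ S' ∧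
            t = HeckeRing0.T M 2 p hp})) = ⟨u, hu⟩ * ⟨v, hv⟩ := rfl
      rw [e, RingHom.map_mul, RingHom.map_mul]
      exact mul_mem ihu ihv
  -- (4) lying over: `j : ℋ/P → 𝓞_K`, a maximal `𝔐 ∋ 3` compatible with `ψ`
  haveI := hfin
  obtain ⟨j, 𝔐, h𝔐, hj, h3𝔐, hcong⟩ :=
    exists_maximal_ideal_over_ker (coeffCharField g) σ hσ hσK Nat.prime_three ψ
  -- (5) `ιg : 𝓞_K → 𝓞_K/𝔐 → k`
  haveI : 𝔐.IsMaximal := h𝔐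
  have hint : ∀ r : ↥(integralClosure ℤ ↥(coeffCharField g)), ∃ f : ℤ[X], f.Monic ∧
      Polynomial.eval₂ (Int.castRingHom _) r f = 0 := fun r ↦ by
    obtain ⟨f, hfm, hf⟩ := integralClosure.isIntegral r
    refine ⟨f, hfm, ?_⟩
    have e : (Int.castRingHom ↥(integralClosure ℤ ↥(coeffCharField g))) = algebraMap ℤ _ := RingHom.ext_int _ _
    rw [e]
    exact hf
  obtain ⟨ι, -⟩ := exists_ringHom_quotient_of_isIntegral hint 𝔐 Nat.prime_three h3𝔐 k
  refine ⟨M', hM'0, hM'M, g, ι.comp (Ideal.Quotient.mk 𝔐), hg, hε, ?_⟩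
  -- (6) the integral Hecke polynomials and their reductions
  intro p hpS hp hp3 hpM
  have hpS' : p ∈ S' := Finset.mem_filter.mpr ⟨hpS, hpM⟩
  set Tp : ↥(Algebra.adjoin ℤ {t : HeckeRing0 M 2 | ∃ (p : ℕ) (hp : p.Prime), p ≠ 3 ∧ p ∈ S' ∧
      t = HeckeRing0.T M 2 p hp}) := ⟨HeckeRing0.T M 2 p hp, Algebra.subset_adjoin ⟨p, hp, hp3, hpS', rfl⟩⟩ with hTp
  obtain ⟨hψp, hcp⟩ := hpk p hp hp3 hpS'
  have hcoef : cuspCoeff g₀ p = σ (Ideal.Quotient.mk P Tp) := hcp hpM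
  set α : ↥(coeffCharIntegers g) := j (Ideal.Quotient.mk P Tp) with hα
  have hαC : (((α : coeffCharField g)) : ℂ) = cuspCoeff g p := by
    rw [hα, hj, ← hcoef, cuspCoeff, cuspCoeff, hcoe]
  have hα𝔐 : α - ((a p : ℤ) : ↥(coeffCharIntegers g)) ∈ 𝔐 := hcong _ (a p) hψp
  refine ⟨X ^ 2 - C α * X + C ((p : ℕ) : ↥(coeffCharIntegers g)), ?_, ?_⟩
  · -- maps to the Hecke polynomial of `g` (trivial character, weight `2`): check in `ℂ[X]`
    apply Polynomial.map_injective (algebraMap (coeffCharField g) ℂ) (algebraMap (coeffCharField g) ℂ).injective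
    rw [Polynomial.map_map, map_heckePolynomial]
    have hεp : (nebentypus g (p : ZMod M') : ℂ) * (p : ℂ) ^ ((2 : ℤ) - 1) = (p : ℕ) := by
      rw [hε, MulChar.one_apply ((ZMod.isUnit_prime_iff_not_dvd hp).mpr (fun h ↦ hpM (h.trans hM'M)))]
      norm_num
    have hαC' : ((algebraMap (coeffCharField g) ℂ).comp (algebraMap ↥(coeffCharIntegers g) (coeffCharField g))) α =
        (UpperHalfPlane.qExpansion 1 ⇑g).coeff p := by
      rw [← cuspCoeff, ← hαC]
      rfl
    rw [hεp, Polynomial.map_add, Polynomial.map_sub, Polynomial.map_mul, Polynomial.map_pow, map_X, map_C, map_C,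
      map_natCast, hαC']
  · have e : (ι.comp (Ideal.Quotient.mk 𝔐)) α = ((a p : ℤ) : k) := by
      have h1 : Ideal.Quotient.mk 𝔐 α = Ideal.Quotient.mk 𝔐 ((a p : ℤ) : ↥(integralClosure ℤ ↥(coeffCharField g))) :=
        Ideal.Quotient.eq.mpr hα𝔐
      rw [RingHom.comp_apply, h1, map_intCast, map_intCast]
    rw [Polynomial.map_add, Polynomial.map_sub, Polynomial.map_mul, Polynomial.map_pow, map_X, map_C, map_C,
      map_natCast]
    exact congrArg (fun t : k ↦ (X ^ 2 - C t * X + C (p : k) : Polynomial k)) e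

end Summit.BirchSwinnertonDyer.BirchSwinnertonDyer.Theorems.TameQuarticManinParity

end
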